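import Summits.AtomisticToContinuum.Crystallization.Theses.MinMeanCycleStackingLock
import Summits.AtomisticToContinuum.Crystallization.Theorems.MinMeanCycleStackingLockLockedPhaseDefectBoundEstimates

/-!
# Route `MinMeanCycleStackingLock`, item stmt-AtomisticToContinuum-12024 `LockedPhaseDefectBound`
# — part 3/3: the locked phase and the assembly

`lockedPhaseDefectBound_proof : LockedPhaseDefectBound` — the quantitative Peierls inequality
behind the Peierls–Karp stability lemma: under a min-mean-cycle certificate `(L, E, u, λ, g)` for
couplings `J` with `Σ k|J_k| < ∞` and `g ≥ 2T`, `T = Σ_{k>L+1} (k+|E|+1)|J_k|`, there are an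
`E`-periodic `w` and a constant `C` with
`(g − 2T)·#{m<n : window_m(s) ∉ E} ≤ haggEnergy n J s − n·haggStackingEnergy J w + C`
for every Hägg sequence `s` and every `n`.

Proof.  `σ` = successor permutation of `E`; `F(x)` = tail energy (`k > L+1`) of the periodic
sequence tracing the `σ`-orbit of `x`; cycle corrector `F = τ + v − v∘σ` (part 1); `w` traces the
orbit of a word `x₀` minimising `τ`, and `haggStackingEnergy J w ≤ λ + τ(x₀)`
(`exists_locked_phase`, a Cesàro bound).  Then `H_n(s) = Σ trunc + Σ tail` and the three
estimates of part 2 give `H_n(s) ≥ n(λ + τ(x₀)) + b·(g − 2t₀ − t₁ − 2|E|t₀) − C` with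
`C = 2Σ|u| + t₁ + 3|E|t₀`, and `2T = 2t₁ + 2(|E|+1)t₀ ≥ 2t₀ + t₁ + 2|E|t₀`.
The constant is cruder than the paper value `osc(u) + t₁ + |E|t₀/2` noted by the refuters; the
statement only asks for some `C`.
-/

namespace Summit.AtomisticToContinuum.Crystallization.Theorems

open Finset Filter Literature.MathematicalPhysics.StatisticalMechanics
open scoped Topology

namespace LockedPhaseDefect

/-! ## The locked phase: a periodic sequence tracing the optimal certificate cycle -/

/-- A Cesàro-type `liminf` bound: if `u n ≤ n·c + C` and `u n ≥ n·B`, then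
`liminf u n / n ≤ c`. -/
theorem liminf_div_le_of_linear_bound {u : ℕ → ℝ} {c C B : ℝ} (hup : ∀ n : ℕ, u n ≤ n * c + C)
    (hlow : ∀ n : ℕ, (n : ℝ) * B ≤ u n) :
    liminf (fun n : ℕ => u n / n) atTop ≤ c := by
  have hbdd : IsBoundedUnder (· ≥ ·) atTop (fun n : ℕ => u n / n) := by
    refine isBoundedUnder_of ⟨min B 0, fun n => ?_⟩
    rcases Nat.eq_zero_or_pos n with rfl | hn
    · simp
    · have hn' : (0 : ℝ) < n := by exact_mod_cast hn
      have : B ≤ u n / n := by rw [le_div_iff₀ hn', mul_comm]; exact hlow n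
      exact (min_le_left _ _).trans this
  refine le_of_forall_pos_le_add fun ε hε => ?_
  refine liminf_le_of_frequently_le (Eventually.frequently ?_) hbdd
  have hC : 0 ≤ max C 0 := le_max_right _ _
  filter_upwards [eventually_gt_atTop 0, eventually_ge_atTop ⌈max C 0 / ε⌉₊] with n hn hnC
  have hn' : (0 : ℝ) < n := by exact_mod_cast hn
  have hnC' : max C 0 / ε ≤ n := (Nat.le_ceil _).trans (by exact_mod_cast hnC)
  rw [div_le_iff₀ hn']
  have h1 : max C 0 ≤ n * ε := by rwa [div_le_iff₀ hε] at hnC'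
  nlinarith [hup n, le_max_left C 0]

/-- **Local energy of a sequence all of whose windows lie in `E`.** If the windows of `w` are
`Y m ∈ E` with `Y (m+1) = σ (Y m)`, the local energy at `m` is `λ + τ(Y m)` plus a coboundary. -/
theorem haggLocalEnergy_locked {L : ℕ} {E : Finset (Fin (L + 1) → ℤ)} (J : ℕ → ℝ)
    (hJa : Summable fun k => |J k|) (u : (Fin L → ℤ) → ℝ) (lam : ℝ)
    (hzero : ∀ x ∈ E, (∀ i, x i = 1 ∨ x i = -1) ∧ (∑ k ∈ Finset.Icc 2 (L + 1),
      if (∑ i : Fin (L + 1), if (i : ℕ) < k then x i else 0) % 3 = 0 then J k else 0) - lam +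
      u (fun i : Fin L => x (Fin.castSucc i)) - u (fun i : Fin L => x (Fin.succ i)) = 0)
    (hpre : ∀ x ∈ E, ∀ y ∈ E, (fun i : Fin L => x (Fin.castSucc i)) =
      (fun i : Fin L => y (Fin.castSucc i)) → x = y)
    (σ : E → E) (hσ : ∀ (x : E) (i : Fin L), (σ x).1 (Fin.castSucc i) = x.1 (Fin.succ i))
    (τ v : E → ℝ) (hF : ∀ x : E,
      (∑' k : ℕ, if L + 1 < k ∧ (∑ t ∈ range k, (σ^[t] x).1 0) % 3 = 0 then J k else 0)
        = τ x + v x - v (σ x))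
    (w : ℤ → ℤ) (Y : ℤ → E) (hY : ∀ m : ℤ, (fun i : Fin (L + 1) => w (m + ((i : ℕ) : ℤ))) = (Y m).1)
    (hYsucc : ∀ m : ℤ, Y (m + 1) = σ (Y m)) (m : ℤ) :
    haggLocalEnergy J w m = lam + τ (Y m)
      + ((u (fun i : Fin L => (Y (m + 1)).1 (Fin.castSucc i)) - v (Y (m + 1)))
        - (u (fun i : Fin L => (Y m).1 (Fin.castSucc i)) - v (Y m))) := by
  rw [haggLocalEnergy_eq_trunc_add_tail hJa L w m]
  -- finite-range part
  have h1 : haggLocalEnergyTrunc (L + 1) J w m = lam - u (fun i : Fin L => (Y m).1 (Fin.castSucc i))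
      + u (fun i : Fin L => (Y (m + 1)).1 (Fin.castSucc i)) := by
    have h := (hzero (Y m).1 (Y m).2).2
    rw [← hY m, cert_energy_eq_haggLocalEnergyTrunc J L w m] at h
    have e3 : (fun i : Fin L => (fun i : Fin (L + 1) => w (m + ((i : ℕ) : ℤ))) (Fin.succ i))
        = fun i : Fin L => (Y (m + 1)).1 (Fin.castSucc i) := by
      rw [hYsucc m]
      funext i
      rw [hσ (Y m) i, ← hY m]
    rw [e3, hY m] at h
    linarith
  -- tail part
  have h2 : (∑' k : ℕ, if L + 1 < k ∧ HaggAligned w m k then J k else 0) = τ (Y m) + v (Y m)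
      - v (Y (m + 1)) := by
    rw [hYsucc m, ← hF (Y m)]
    refine tsum_congr fun k => ?_
    have hgood : ∀ j : ℕ, j ≤ k → (fun i : Fin (L + 1) => w (m + (j : ℤ) + ((i : ℕ) : ℤ))) ∈ E := by
      intro j _
      rw [hY (m + j)]
      exact (Y (m + j)).2
    have hw := haggWindow_eq_orbit_sum σ hσ hpre w m k (Y m) (hY m).symm hgood k (by omega)
    unfold HaggAligned
    rw [hw]
  rw [h1, h2]
  ring

/-- **The locked phase.** Tracing the `σ`-orbit of a certificate word `x₀` gives a periodic
sequence all of whose windows lie in `E` and whose stacking energy density is at most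
`λ + τ(x₀)`. -/
theorem exists_locked_phase {L : ℕ} {E : Finset (Fin (L + 1) → ℤ)} (J : ℕ → ℝ)
    (hJ : Summable fun k : ℕ => (k : ℝ) * |J k|) (u : (Fin L → ℤ) → ℝ) (lam : ℝ)
    (hzero : ∀ x ∈ E, (∀ i, x i = 1 ∨ x i = -1) ∧ (∑ k ∈ Finset.Icc 2 (L + 1),
      if (∑ i : Fin (L + 1), if (i : ℕ) < k then x i else 0) % 3 = 0 then J k else 0) - lam +
      u (fun i : Fin L => x (Fin.castSucc i)) - u (fun i : Fin L => x (Fin.succ i)) = 0)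
    (hpre : ∀ x ∈ E, ∀ y ∈ E, (fun i : Fin L => x (Fin.castSucc i)) =
      (fun i : Fin L => y (Fin.castSucc i)) → x = y)
    (σ : E → E) (hσinj : Function.Injective σ)
    (hσ : ∀ (x : E) (i : Fin L), (σ x).1 (Fin.castSucc i) = x.1 (Fin.succ i))
    (τ v : E → ℝ) (V : ℝ) (hF : ∀ x : E,
      (∑' k : ℕ, if L + 1 < k ∧ (∑ t ∈ range k, (σ^[t] x).1 0) % 3 = 0 then J k else 0)
        = τ x + v x - v (σ x))
    (hτ : ∀ x, τ (σ x) = τ x) (hV : ∀ x, |v x| ≤ V) (x₀ : E) :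
    ∃ (w : ℤ → ℤ) (p : ℕ), 0 < p ∧ (∀ i, w (i + p) = w i) ∧
      (∀ m : ℤ, (fun i : Fin (L + 1) => w (m + ((i : ℕ) : ℤ))) ∈ E) ∧
      haggStackingEnergy J w ≤ lam + τ x₀ := by
  classical
  have hJa : Summable fun k => |J k| := summable_abs_of_summable_mul_abs hJ
  -- the successor permutation and its orbit through x₀
  set π : Equiv.Perm E := Equiv.ofBijective σ (Finite.injective_iff_bijective.mp hσinj) with hπ
  have hiter : ∀ (j : ℕ) (y : E), (π ^ j) y = σ^[j] y := by
    intro j y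
    rw [← Equiv.Perm.iterate_eq_pow]
    rfl
  set p := Function.minimalPeriod σ x₀ with hp_def
  have hp : 0 < p := (minimalPeriod_pos_and_le_card σ hσinj x₀).1
  have hfix : (π ^ (p : ℤ)) x₀ = x₀ := by
    rw [zpow_natCast, hiter]; exact Function.iterate_minimalPeriod
  set Y : ℤ → E := fun m => (π ^ m) x₀ with hY_def
  set w : ℤ → ℤ := fun m => (Y m).1 0 with hw_def
  have hYsucc : ∀ m : ℤ, Y (m + 1) = σ (Y m) := by
    intro m
    simp only [hY_def]
    rw [add_comm m 1, zpow_one_add, Equiv.Perm.mul_apply]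
    rfl
  have hYwin : ∀ m : ℤ, (fun i : Fin (L + 1) => w (m + ((i : ℕ) : ℤ))) = (Y m).1 := by
    intro m
    funext i
    simp only [hw_def, hY_def]
    rw [add_comm m _, zpow_add, Equiv.Perm.mul_apply, zpow_natCast, hiter]
    exact (letter_eq_iterate σ hσ i _ i.isLt).symm
  refine ⟨w, p, hp, fun i => ?_, fun m => ?_, ?_⟩
  · -- periodicity
    simp only [hw_def, hY_def]
    rw [zpow_add, Equiv.Perm.mul_apply, hfix]
  · -- windows in E
    rw [hYwin m]; exact (Y m).2
  · -- energy density
    have hτY : ∀ m : ℕ, τ (Y m) = τ x₀ := by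
      intro m
      induction m with
      | zero => simp [hY_def]
      | succ m ih => rw [Nat.cast_succ, hYsucc, hτ, ih]
    set P : ℤ → ℝ := fun m => u (fun i : Fin L => (Y m).1 (Fin.castSucc i)) - v (Y m) with hP
    have hloc : ∀ m : ℕ, haggLocalEnergy J w m = lam + τ x₀ + (P ((m + 1 : ℕ) : ℤ) - P m) := by
      intro m
      rw [haggLocalEnergy_locked J hJa u lam hzero hpre σ hσ τ v hF w Y hYwin hYsucc m, hτY m]
      simp only [hP, Nat.cast_succ]
    have hH : ∀ n : ℕ, haggEnergy n J w = n * (lam + τ x₀) + (P n - P 0) := by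
      intro n
      unfold haggEnergy
      rw [sum_congr rfl fun m _ => hloc m, sum_add_distrib, sum_const, card_range, nsmul_eq_mul,
        Finset.sum_range_sub (fun m : ℕ => P m)]
      simp
    -- bounds on the coboundary
    set Mu := ∑ y ∈ Fintype.piFinset (fun _ : Fin L => ({1, -1} : Finset ℤ)), |u y| with hMu
    have hPle : ∀ m : ℤ, |P m| ≤ Mu + V := by
      intro m
      have hmem : (fun i : Fin L => (Y m).1 (Fin.castSucc i)) ∈
          Fintype.piFinset (fun _ : Fin L => ({1, -1} : Finset ℤ)) := by
        refine Fintype.mem_piFinset.mpr fun i => ?_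
        rcases (hzero (Y m).1 (Y m).2).1 (Fin.castSucc i) with h | h <;> simp [h]
      have h1 := abs_apply_le_sum_abs u hmem
      have h2 := hV (Y m)
      simp only [hP]
      exact (abs_sub _ _).trans (add_le_add h1 h2)
    unfold haggStackingEnergy
    refine liminf_div_le_of_linear_bound (C := 2 * (Mu + V)) (B := -(∑' k : ℕ, |J k|))
      (fun n => ?_) (fun n => ?_)
    · rw [hH n]
      have h0 := hPle 0
      have hn := hPle n
      rw [abs_le] at h0 hn
      linarith [h0.1, h0.2, hn.1, hn.2]
    · unfold haggEnergy
      have := sum_le_sum fun m (_ : m ∈ range n) => neg_tsum_abs_le_haggLocalEnergy hJa w m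
      rw [sum_const, card_range, nsmul_eq_mul] at this
      exact this

/-! ## Assembly -/

/-- The ideal tail energy along an orbit is bounded by the tail mass `t₀`. -/
theorem abs_tsum_ite_and_le {J : ℕ → ℝ} (hJ : Summable fun k => |J k|) (P Q : ℕ → Prop)
    [DecidablePred P] [DecidablePred Q] :
    |∑' k : ℕ, if P k ∧ Q k then J k else 0| ≤ ∑' k : ℕ, if P k then |J k| else 0 := by
  rw [abs_le]
  constructor
  · rw [← tsum_neg]
    refine Summable.tsum_le_tsum (fun k => ?_) (summable_ite_abs_of_summable_abs hJ _).neg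
      (summable_ite_of_summable_abs hJ _)
    by_cases hP : P k
    · by_cases hQ : Q k
      · rw [if_pos hP, if_pos ⟨hP, hQ⟩]; exact neg_abs_le _
      · rw [if_pos hP, if_neg (fun h => hQ h.2)]; simp
    · rw [if_neg hP, if_neg (fun h => hP h.1)]; simp
  · refine Summable.tsum_le_tsum (fun k => ?_) (summable_ite_of_summable_abs hJ _)
      (summable_ite_abs_of_summable_abs hJ _)
    by_cases hP : P k
    · by_cases hQ : Q k
      · rw [if_pos hP, if_pos ⟨hP, hQ⟩]; exact le_abs_self _
      · rw [if_pos hP, if_neg (fun h => hQ h.2)]; exact abs_nonneg _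
    · rw [if_neg hP, if_neg (fun h => hP h.1)]

/-- The Peierls tail constant splits as `T = t₁ + (|E|+1)·t₀`. -/
theorem tail_constant_eq {J : ℕ → ℝ} (hJ : Summable fun k : ℕ => (k : ℝ) * |J k|) (L : ℕ)
    (c : ℝ) :
    (∑' k : ℕ, if L + 1 < k then ((k : ℝ) + c + 1) * |J k| else 0) =
      (∑' k : ℕ, if L + 1 < k then (k : ℝ) * |J k| else 0)
        + (c + 1) * (∑' k : ℕ, if L + 1 < k then |J k| else 0) := by
  have hJa : Summable fun k => |J k| := summable_abs_of_summable_mul_abs hJ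
  rw [← Summable.tsum_mul_left _ (summable_ite_abs_of_summable_abs hJa _), ← Summable.tsum_add
    (summable_ite_mul_abs hJ _) ((summable_ite_abs_of_summable_abs hJa _).mul_left _)]
  refine tsum_congr fun k => ?_
  split_ifs <;> ring

end LockedPhaseDefect

open LockedPhaseDefect in
/-- **Item stmt-AtomisticToContinuum-12024** (`LockedPhaseDefectBound`, route
`MinMeanCycleStackingLock`): the quantitative Peierls estimate of the locked stacking phase.
Under a min-mean-cycle certificate `(L, E, u, λ, g)` whose gap dominates twice the tail constant
`T = Σ_{k>L+1}(k+|E|+1)|J_k|`, the `E`-periodic sequence `w` tracing the certificate cycle of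
minimal tail energy satisfies, for every Hägg sequence `s` and every `n`,
`(g − 2T)·#{m<n : window_m(s) ∉ E} ≤ H_n(J,s) − n·e(J,w) + C` with
`C = 2Σ|u| + Σ_{k>L+1} k|J_k| + 3|E|·Σ_{k>L+1}|J_k|`. Proof: telescoping of the node potentials
(finite range), a cycle corrector for the tail energy along followed stretches, and a count of
the positions whose look-ahead meets a bad window. -/
theorem lockedPhaseDefectBound_proof :
    Summit.AtomisticToContinuum.Crystallization.Theses.MinMeanCycleStackingLock.LockedPhaseDefectBound := by
  unfold Summit.AtomisticToContinuum.Crystallization.Theses.MinMeanCycleStackingLock.LockedPhaseDefectBound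
  intro J L E u lam g hJ hE hpre hsuf hcont hzero hgap hg
  have hJa : Summable fun k => |J k| := summable_abs_of_summable_mul_abs hJ
  -- the successor structure of the certificate set
  obtain ⟨σ, hσinj, hσ⟩ := exists_successor E hsuf hcont
  -- tail masses
  set t0 := ∑' k : ℕ, if L + 1 < k then |J k| else 0 with ht0
  set t1 := ∑' k : ℕ, if L + 1 < k then (k : ℝ) * |J k| else 0 with ht1
  have ht0nn : 0 ≤ t0 := tsum_nonneg fun k => by split_ifs <;> simp
  have ht1nn : 0 ≤ t1 := tsum_nonneg fun k => by
    split_ifs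
    · exact mul_nonneg (Nat.cast_nonneg k) (abs_nonneg _)
    · exact le_rfl
  have hT : (∑' k : ℕ, if L + 1 < k then ((k : ℝ) + E.card + 1) * |J k| else 0) =
      t1 + (E.card + 1) * t0 := tail_constant_eq hJ L _
  -- ideal tail energy along certificate orbits and its cycle corrector
  set F : E → ℝ := fun x =>
    ∑' k : ℕ, if L + 1 < k ∧ (∑ t ∈ Finset.range k, (σ^[t] x).1 0) % 3 = 0 then J k else 0 with hF
  have hFle : ∀ x, |F x| ≤ t0 := fun x => abs_tsum_ite_and_le hJa _ _
  obtain ⟨τ, v, hFτ, hτσ, hτle, hvle⟩ := exists_cycle_corrector σ hσinj F t0 hFle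
  rw [Fintype.card_coe] at hvle
  set V := (E.card : ℝ) * t0 with hV
  have hV0 : 0 ≤ V := mul_nonneg (Nat.cast_nonneg _) ht0nn
  -- the certificate cycle of minimal tail energy
  haveI : Nonempty E := hE.coe_sort
  obtain ⟨x₀, -, hx₀⟩ := Finset.exists_min_image Finset.univ τ Finset.univ_nonempty
  obtain ⟨w, p, hp, hper, hwin, hew⟩ :=
    exists_locked_phase J hJ u lam hzero hpre σ hσinj hσ τ v V hFτ hτσ hvle x₀
  set Mu := ∑ y ∈ Fintype.piFinset (fun _ : Fin L => ({1, -1} : Finset ℤ)), |u y| with hMu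
  refine ⟨w, p, 2 * Mu + t1 + 3 * V, hp, hper, hwin, fun s n hs => ?_⟩
  -- the three estimates
  have h0 := trunc_sum_lower_bound J L E u lam g hzero hgap s hs n
  have h1 := tail_sum_lower_bound J hJ hpre σ hσ F (fun x => rfl) s n
  have hτ0 : |τ x₀| ≤ t0 := hτle x₀
  have h2 := orbit_sum_lower_bound hpre σ hσ F τ v (τ x₀) V t0 hFτ
    (fun x => hx₀ x (Finset.mem_univ x)) hτ0 hvle hV0 s n
  -- range splitting of the energy
  have hdec : haggEnergy n J s = ∑ m ∈ Finset.range n, haggLocalEnergyTrunc (L + 1) J s m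
      + ∑ m ∈ Finset.range n, ∑' k : ℕ, if L + 1 < k ∧ HaggAligned s m k then J k else 0 := by
    unfold haggEnergy
    rw [← Finset.sum_add_distrib]
    exact Finset.sum_congr rfl fun m _ => haggLocalEnergy_eq_trunc_add_tail hJa L s m
  have h3 : (n : ℝ) * haggStackingEnergy J w ≤ n * (lam + τ x₀) :=
    mul_le_mul_of_nonneg_left hew (Nat.cast_nonneg n)
  set b := (((Finset.range n).filter (fun m : ℕ =>
        (fun i : Fin (L + 1) => s ((m : ℤ) + ((i : ℕ) : ℤ))) ∉ E)).card : ℝ) with hb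
  have hb0 : 0 ≤ b := Nat.cast_nonneg _
  have hcoef : (g - 2 * (∑' k : ℕ, if L + 1 < k then ((k : ℝ) + E.card + 1) * |J k| else 0)) * b
      ≤ (g - 2 * t0 - t1 - 2 * V) * b := by
    refine mul_le_mul_of_nonneg_right ?_ hb0
    rw [hT, hV]
    nlinarith
  rw [hdec]
  nlinarith [h0, h1, h2, h3, hcoef]

end Summit.AtomisticToContinuum.Crystallization.Theorems
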